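import Mathlib
import Literature.AlgebraicGeometry.Resolution.CurveDeltaInvariant
import HarnessLib

/-!
# The `δ`-invariant drops under blowing up: `Σ_{x'} δ(x') < δ(x)`

Topic: `Literature/AlgebraicGeometry/Resolution`. Second file of the `δ`-theory behind "by
embedded resolution of curves" in the proof of [CoP1] = Cossart–Piltant 2008, Prop. 4.4 (steps
1–2 of the algorithm, p. 10): the classical fact that for a singular point `x` of a reduced
excellent curve `C` and the blowing up `C' → C` of `x`, the `δ`-invariants of the (finitely many)
points `x'` of `C'` over `x` satisfy **`Σ_{x'} δ(x') < δ(x)`** (Kollár 2007, §1.4), so that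
blowing up singular points finitely often resolves `C`. This file proves the RING-THEORETIC
heart, for a one-dimensional Noetherian local domain `(R, 𝔪)` with fraction field `K` and
module-finite normalization `R̄ ⊆ K`, and a finite family `S_i ⊆ K` of intermediate local domains
abstracting the local rings `𝒪_{C',x'}` (`IsFirstNeighbourhood`: each `S_i` is a one-dimensional
Noetherian local domain with finite normalization, `𝔪 ⊆ t_i S_i` for some `t_i ∈ 𝔪` — the
exceptional divisor is Cartier — and every branch of `R`, i.e. every maximal ideal of the
semilocal Dedekind domain `R̄`, dominates exactly one `S_i`):

* `exists_heightOneSpectrum_eq_valuationSubring` — every discrete valuation ring of `K`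
  containing `R̄` is a localization `R̄_𝔑`;
* `IsFirstNeighbourhood.exists_branch_of_heightOneSpectrum` — the branches of `S_i` are branches
  of `R` through `x'_i`; `IsFirstNeighbourhood.exists_bound` — **conductor estimate**: elements of
  `K` of large valuation at all branches through `x'_i` lie in `S_i`;
* `IsFirstNeighbourhood.exists_forall_valuation_sub_le`, `exists_partition`,
  `exists_partition_mem` — approximation in `R̄` and elements `s_i ∈ ⋂_j S_j` with `s_i ≡ 1` at
  the branches of `x'_i` and `s_i ≡ 0` at the other branches (Chinese remainder theorem in `R̄`);
* `IsFirstNeighbourhood.iInf_le_integralClosure`, `exists_mem_iInf_notMem_bot` — the first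
  neighbourhood ring `R₁ = ⋂_i S_i` lies in `R̄`, and **`R₁ ≠ R` unless `R` is regular**:
  `u = Σ s_i t_i` generates `𝔪 S_j` for all `j`, so `𝔪 ⊆ u R₁`;
* `IsFirstNeighbourhood.sum_curveDelta_lt` — **`Σ_i δ(S_i) < δ(R)`** for non-regular `R`:
  `R̄/R₁ ≅ ⊕_i S̄_i/S_i` (approximation in `R̄`), lengths over `R` dominate lengths over `S_i`,
  and `length_R(R₁/R) ≥ 1`.

## Sources

* J. Kollár, *Lectures on Resolution of Singularities* (2007), §1.4. [Kollar2007]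
* V. Cossart, O. Piltant, J. Algebra 320 (2008), proof of Prop. 4.4, p. 10. [CossartPiltant2008]
-/

noncomputable section

open IsLocalRing IsDedekindDomain

namespace Literature.AlgebraicGeometry.Resolution

universe u

section Setup

variable (R : Type u) [CommRing R] [IsDomain R] (K : Type u) [Field K] [Algebra R K]
  [IsFractionRing R K]

/-- The normalization of a Noetherian domain of dimension `≤ 1` is a Dedekind domain when it is
module-finite (general fraction field; cf. `isDedekindDomain_integralClosure_of_finite`).
[folklore] -/
theorem isDedekindDomain_integralClosure_of_module_finite [IsNoetherianRing R]
    (hdim : ringKrullDim R ≤ 1) [Module.Finite R (integralClosure R K)] :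
    IsDedekindDomain (integralClosure R K) := by
  haveI : IsNoetherianRing (integralClosure R K) :=
    isNoetherian_of_tower R (isNoetherian_of_isNoetherianRing_of_finite R _)
  haveI : Ring.KrullDimLE 1 R := Ring.krullDimLE_iff.mpr hdim
  haveI : Ring.DimensionLEOne R :=
    ⟨fun hne hp => (Ring.krullDimLE_one_iff_of_noZeroDivisors.mp inferInstance) _ hne hp⟩
  haveI : IsFractionRing (integralClosure R K) K :=
    integralClosure.isFractionRing_of_finite_extension K K
  haveI : IsIntegrallyClosed (integralClosure R K) :=
    (isIntegrallyClosed_iff_isIntegrallyClosedIn K).mpr inferInstance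
  exact { }

/-- `K` is the fraction field of `R̄`. [folklore] -/
theorem isFractionRing_integralClosure : IsFractionRing (integralClosure R K) K :=
  integralClosure.isFractionRing_of_finite_extension K K

attribute [local instance] isFractionRing_integralClosure

/-- The maximal ideals of `R̄` (a semilocal ring: they lie over `𝔪`) are finite in number.
[folklore] -/
theorem finite_heightOneSpectrum [IsNoetherianRing R] [IsLocalRing R]
    [Module.Finite R (integralClosure R K)] [IsDedekindDomain (integralClosure R K)] :
    Finite (HeightOneSpectrum (integralClosure R K)) := by
  haveI : Algebra.IsIntegral R (integralClosure R K) := Algebra.IsIntegral.of_finite R _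
  have hfin := IsDedekindDomain.primesOver_finite (maximalIdeal R) (integralClosure R K)
  haveI := hfin.to_subtype
  refine Finite.of_injective (fun v : HeightOneSpectrum (integralClosure R K) =>
    (⟨v.asIdeal, ?_⟩ : (maximalIdeal R).primesOver (integralClosure R K))) ?_
  · haveI : v.asIdeal.IsMaximal := v.isPrime.isMaximal v.ne_bot
    refine ⟨v.isPrime, ⟨?_⟩⟩
    exact (IsLocalRing.eq_maximalIdeal
      (Ideal.isMaximal_comap_of_isIntegral_of_isMaximal (R := R) v.asIdeal)).symm
  · intro v w h
    exact HeightOneSpectrum.ext (congrArg Subtype.val h)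

variable {R K}

/-- Membership in the localization `R̄_𝔑 ⊆ K` at a maximal ideal. [folklore] -/
theorem mem_valuationSubringAtPrime_iff_exists [IsDedekindDomain (integralClosure R K)]
    (v : HeightOneSpectrum (integralClosure R K)) (x : K) :
    x ∈ v.valuationSubringAtPrime K ↔ ∃ a s : integralClosure R K, s ∉ v.asIdeal ∧
      x = algebraMap _ K a * (algebraMap _ K s)⁻¹ := by
  change x ∈ {x : K | ∃ (a s : integralClosure R K) (_ : s ∈ v.asIdeal.primeCompl),
    x = algebraMap _ K a * (algebraMap _ K s)⁻¹} ↔ _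
  simp only [Set.mem_setOf_eq, Ideal.mem_primeCompl_iff, exists_prop]

omit [IsDomain R] [IsFractionRing R K] in
/-- **Valuation rings of `K` containing `R` contain `R̄`** (they are integrally closed).
[folklore] -/
theorem integralClosure_le_valuationSubring (W : ValuationSubring K)
    (hW : ∀ r : R, algebraMap R K r ∈ W) (x : K) (hx : x ∈ integralClosure R K) : x ∈ W := by
  -- `x` is integral over `W`, which is integrally closed in `K`
  obtain ⟨p, hp, hpx⟩ := hx
  let f : R →+* W := (algebraMap R K).codRestrict W.toSubring hW
  have hf : (algebraMap W K).comp f = algebraMap R K := RingHom.ext fun _ => rfl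
  have hint : IsIntegral W x := by
    refine ⟨p.map f, hp.map f, ?_⟩
    rw [Polynomial.eval₂_map, hf]
    exact hpx
  obtain ⟨w, hw⟩ := (IsIntegrallyClosed.isIntegral_iff (R := W) (K := K)).mp hint
  rw [← hw]; exact w.2

/-- **Every discrete valuation ring of `K` containing `R̄` is a localization `R̄_𝔑`** at a
maximal ideal (`R̄` is a Dedekind domain with fraction field `K`). [folklore] -/
theorem exists_heightOneSpectrum_eq_valuationSubring [IsDedekindDomain (integralClosure R K)]
    (W : ValuationSubring K) [Ring.KrullDimLE 1 W] (hWtop : W ≠ ⊤)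
    (hW : ∀ a : integralClosure R K, (a : K) ∈ W) :
    ∃ v : HeightOneSpectrum (integralClosure R K), v.valuationSubringAtPrime K = W := by
  classical
  -- the centre of `W` on `R̄`
  let φ : integralClosure R K →+* W := (algebraMap (integralClosure R K) K).codRestrict
    W.toSubring (fun a => hW a)
  let 𝔑 : Ideal (integralClosure R K) := (IsLocalRing.maximalIdeal W).comap φ
  haveI h𝔑p : 𝔑.IsPrime := Ideal.IsPrime.comap φ
  have h𝔑 : 𝔑 ≠ ⊥ := by
    intro hbot
    apply hWtop
    -- every element of `K` is `a/b` with `b` a unit of `W`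
    refine eq_top_iff.mpr fun x _ => ?_
    obtain ⟨a, b, hb, rfl⟩ := IsFractionRing.div_surjective (A := integralClosure R K) x
    have hb0 : (b : integralClosure R K) ≠ 0 := nonZeroDivisors.ne_zero hb
    have hbu : IsUnit (φ b) := by
      by_contra hnu
      have : (b : integralClosure R K) ∈ 𝔑 := (IsLocalRing.mem_maximalIdeal _).mpr hnu
      rw [hbot] at this
      exact hb0 this
    have : algebraMap _ K a / algebraMap _ K b = ((φ a * (hbu.unit⁻¹ : Wˣ) : W) : K) := by
      rw [Subring.coe_mul, div_eq_mul_inv]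
      congr 1
      have h1 : ((hbu.unit⁻¹ : Wˣ) : W) * φ b = 1 := hbu.val_inv_mul
      have h2 := congrArg (fun w : W => (w : K)) h1
      simp only [OneMemClass.coe_one] at h2
      exact (eq_inv_of_mul_eq_one_left h2).symm
    rw [this]
    exact SetLike.coe_mem _
  let v : HeightOneSpectrum (integralClosure R K) := ⟨𝔑, h𝔑p, h𝔑⟩
  refine ⟨v, ValuationSubring.eq_of_le_of_ne_top (v.valuationSubringAtPrime K)
    (fun x hx => ?_) hWtop⟩
  obtain ⟨a, s, hs, rfl⟩ := (mem_valuationSubringAtPrime_iff_exists v x).mp hx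
  have hsu : IsUnit (φ s) := by
    by_contra hnu
    exact hs ((IsLocalRing.mem_maximalIdeal _).mpr hnu)
  have : algebraMap _ K a * (algebraMap _ K s)⁻¹ = ((φ a * (hsu.unit⁻¹ : Wˣ) : W) : K) := by
    rw [Subring.coe_mul]
    congr 1
    have h1 : ((hsu.unit⁻¹ : Wˣ) : W) * φ s = 1 := hsu.val_inv_mul
    have h2 := congrArg (fun w : W => (w : K)) h1
    simp only [OneMemClass.coe_one] at h2
    exact (eq_inv_of_mul_eq_one_left h2).symm
  rw [this]
  exact SetLike.coe_mem _

end Setup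

/-! ## The first neighbourhood of a one-dimensional local domain -/

section Drop

variable {R : Type u} [CommRing R] [IsDomain R] [IsLocalRing R]
  {K : Type u} [Field K] [Algebra R K] [IsFractionRing R K] {ι : Type u}

attribute [local instance] isFractionRing_integralClosure

/-- **The local rings of the first neighbourhood.** Abstract form of the family of local rings
`S_i = 𝒪_{C',x'_i} ⊆ K` of the blowing up `C' → C = Spec R` of the closed point at its points
`x'_i` over it: each `S_i` is a one-dimensional Noetherian local domain between `R` and `K` with
module-finite normalization; the maximal ideal of `R` becomes divisible by a single `t_i ∈ 𝔪` in
`S_i` (the exceptional divisor is Cartier); and every branch of `R` — every maximal ideal `𝔑` of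
the semilocal Dedekind domain `R̄`, with its discrete valuation `v_𝔑` of `K` — dominates exactly
one `S_i` (the valuative criterion for the proper birational `C' → C`). [cite: Kollar2007, §1.4] -/
structure IsFirstNeighbourhood [IsDedekindDomain (integralClosure R K)]
    (S : ι → Subalgebra R K) : Prop where
  isLocalRing : ∀ i, IsLocalRing (S i)
  isNoetherianRing : ∀ i, IsNoetherianRing (S i)
  ringKrullDim_eq_one : ∀ i, ringKrullDim (S i) = 1
  module_finite : ∀ i, Module.Finite (S i) (integralClosure (S i) K)
  exists_generator : ∀ i, ∃ t ∈ maximalIdeal R, ∀ m ∈ maximalIdeal R,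
    ∃ b ∈ S i, algebraMap R K m = algebraMap R K t * b
  existsUnique_branch : ∀ v : HeightOneSpectrum (integralClosure R K),
    ∃! i, ∀ x ∈ S i, v.valuation K x ≤ 1

variable [IsDedekindDomain (integralClosure R K)] {S : ι → Subalgebra R K}

namespace IsFirstNeighbourhood

/-- The normalization `S̄_i` of `S_i` is a Dedekind domain. [folklore] -/
theorem isDedekindDomain (hS : IsFirstNeighbourhood S) (i : ι) :
    IsDedekindDomain (integralClosure (S i) K) := by
  haveI := hS.isNoetherianRing i
  haveI := hS.module_finite i
  exact isDedekindDomain_integralClosure_of_module_finite (S i) K (hS.ringKrullDim_eq_one i).le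

omit [IsDomain R] [IsLocalRing R] [IsFractionRing R K] [IsDedekindDomain (integralClosure R K)] in
/-- `R̄ ⊆ S̄_i`. [folklore] -/
theorem coe_mem_integralClosure (i : ι) (a : integralClosure R K) :
    (a : K) ∈ integralClosure (S i) K := by
  have h : IsIntegral R (a : K) := a.2
  exact h.tower_top

/-- **Branches of `S_i` are branches of `R` through `x'_i`**: for every maximal ideal `𝔑'` of
`S̄_i` there is a maximal ideal `𝔑` of `R̄` dominating `S_i` with `R̄_𝔑 = (S̄_i)_{𝔑'}`, i.e.
with the same valuation ring in `K`. [cite: Kollar2007, §1.4] -/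
theorem exists_branch_of_heightOneSpectrum (hS : IsFirstNeighbourhood S) (i : ι)
    (w : HeightOneSpectrum (integralClosure (S i) K)) :
    haveI := hS.isDedekindDomain i
    ∃ v : HeightOneSpectrum (integralClosure R K), (∀ x ∈ S i, v.valuation K x ≤ 1) ∧
      ∀ y : K, w.valuation K y ≤ 1 ↔ v.valuation K y ≤ 1 := by
  haveI := hS.isDedekindDomain i
  let W : ValuationSubring K := w.valuationSubringAtPrime K
  haveI : Ring.KrullDimLE 1 W := inferInstanceAs (Ring.KrullDimLE 1 (w.valuationSubringAtPrime K))
  have hWeq : W = (w.valuation K).valuationSubring :=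
    HeightOneSpectrum.valuationSubringAtPrime_eq_valuationSubring w
  have hmemW : ∀ y : K, y ∈ W ↔ w.valuation K y ≤ 1 := fun y => by
    rw [hWeq]; exact Valuation.mem_valuationSubring_iff _ _
  -- `W ≠ K`
  have hWtop : W ≠ ⊤ := by
    intro htop
    obtain ⟨z, hz⟩ := HeightOneSpectrum.valuation_surjective (K := K) w (WithZero.exp 1)
    have hzW : z ∈ W := by rw [htop]; exact ValuationSubring.mem_top z
    rw [hmemW, hz, ← WithZero.exp_zero, WithZero.exp_le_exp] at hzW
    exact absurd hzW (by norm_num)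
  -- `S_i ⊆ S̄_i ⊆ W`, hence `R ⊆ W` and `R̄ ⊆ W`
  have hSW : ∀ x ∈ S i, x ∈ W := fun x hx => by
    rw [hmemW]
    have := HeightOneSpectrum.valuation_le_one (K := K) w
      (algebraMap (S i) (integralClosure (S i) K) ⟨x, hx⟩)
    exact this
  have hΛW : ∀ a : integralClosure R K, (a : K) ∈ W := fun a =>
    integralClosure_le_valuationSubring (R := R) W
      (fun r => hSW _ ((S i).algebraMap_mem r)) a a.2
  obtain ⟨v, hv⟩ := exists_heightOneSpectrum_eq_valuationSubring (R := R) (K := K) W hWtop hΛW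
  have hmemV : ∀ y : K, y ∈ W ↔ v.valuation K y ≤ 1 := fun y => by
    rw [← hv, HeightOneSpectrum.valuationSubringAtPrime_eq_valuationSubring v]
    exact Valuation.mem_valuationSubring_iff _ _
  exact ⟨v, fun x hx => (hmemV x).mp (hSW x hx), fun y => (hmemW y).symm.trans (hmemV y)⟩

/-- Every `S_i` is dominated by some branch. [folklore] -/
theorem exists_branch (hS : IsFirstNeighbourhood S) (i : ι) :
    ∃ v : HeightOneSpectrum (integralClosure R K), ∀ x ∈ S i, v.valuation K x ≤ 1 := by
  haveI := hS.isDedekindDomain i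
  haveI := hS.isLocalRing i
  -- `S̄_i` is not a field (it is integral over the non-field `S_i`), so it has a maximal ideal
  have hnf : ¬ IsField (S i) :=
    (ringKrullDim_eq_one_iff_of_isLocalRing_isDomain.mp (hS.ringKrullDim_eq_one i)).1
  have hnf' : ¬ IsField (integralClosure (S i) K) := by
    intro hF
    haveI : Algebra.IsIntegral (S i) (integralClosure (S i) K) := inferInstance
    exact hnf ((Algebra.IsIntegral.isField_iff_isField (R := S i)
      (S := integralClosure (S i) K)
      (fun x y h => Subtype.ext (by simpa using congrArg Subtype.val h))).mpr hF)
  obtain ⟨𝔑, h𝔑⟩ := Ideal.exists_maximal (integralClosure (S i) K)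
  have h𝔑0 : 𝔑 ≠ ⊥ := Ring.ne_bot_of_isMaximal_of_not_isField h𝔑 hnf'
  obtain ⟨v, hv, -⟩ := hS.exists_branch_of_heightOneSpectrum i ⟨𝔑, h𝔑.isPrime, h𝔑0⟩
  exact ⟨v, hv⟩

/-- **Conductor estimate**: for each `i` there is `M` such that every `x ∈ K` of valuation
`≤ exp(-M)` at all branches through `x'_i` lies in `S_i` — indeed in the conductor `c S̄_i ⊆ S_i`
of the finite normalization. [cite: Kollar2007, §1.4] -/
theorem exists_bound [IsNoetherianRing R] [Module.Finite R (integralClosure R K)]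
    (hS : IsFirstNeighbourhood S) (i : ι) :
    ∃ M : ℕ, ∀ x : K, (∀ v : HeightOneSpectrum (integralClosure R K),
      (∀ y ∈ S i, v.valuation K y ≤ 1) → v.valuation K x ≤ WithZero.exp (-(M : ℤ))) →
      x ∈ S i := by
  classical
  haveI := hS.isDedekindDomain i
  haveI := hS.isLocalRing i
  haveI := hS.isNoetherianRing i
  haveI := hS.module_finite i
  haveI : Finite (HeightOneSpectrum (integralClosure R K)) := finite_heightOneSpectrum R K
  haveI : Fintype (HeightOneSpectrum (integralClosure R K)) := Fintype.ofFinite _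
  -- a common denominator `c ∈ S_i` of `S̄_i`
  obtain ⟨c, hc0, hc⟩ := exists_ne_zero_smul_mem_baseSubmodule (R := S i) (K := K)
  have hcK : (c : K) ≠ 0 := fun h => hc0 (Subtype.ext h)
  -- a bound `exp(-M) ≤ v(c)` for all branches
  have hMv : ∀ v : HeightOneSpectrum (integralClosure R K), ∃ M : ℕ,
      WithZero.exp (-(M : ℤ)) ≤ v.valuation K (c : K) := by
    intro v
    have hne : v.valuation K (c : K) ≠ 0 := (Valuation.ne_zero_iff _).mpr hcK
    obtain ⟨k, hk⟩ : ∃ k : ℤ, v.valuation K (c : K) = WithZero.exp k :=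
      ⟨WithZero.log (v.valuation K (c : K)), (WithZero.exp_log hne).symm⟩
    refine ⟨k.natAbs, ?_⟩
    rw [hk, WithZero.exp_le_exp]
    omega
  choose Mv hMv using hMv
  refine ⟨Finset.univ.sup Mv, fun x hx => ?_⟩
  -- `y = x / c` is integral over `S_i`: its valuation is `≤ 1` at every maximal ideal of `S̄_i`
  have hy : ∀ w : HeightOneSpectrum (integralClosure (S i) K),
      w.valuation K (x * (c : K)⁻¹) ≤ 1 := by
    intro w
    obtain ⟨v, hvB, hvw⟩ := hS.exists_branch_of_heightOneSpectrum i w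
    rw [hvw, map_mul, map_inv₀]
    have h1 := hx v hvB
    have h2 : WithZero.exp (-((Finset.univ.sup Mv : ℕ) : ℤ)) ≤ WithZero.exp (-(Mv v : ℤ)) := by
      rw [WithZero.exp_le_exp, neg_le_neg_iff, Int.ofNat_le]
      exact Finset.le_sup (Finset.mem_univ v)
    have h3 := hMv v
    have hne : v.valuation K (c : K) ≠ 0 := (Valuation.ne_zero_iff _).mpr hcK
    calc v.valuation K x * (v.valuation K (c : K))⁻¹
        ≤ v.valuation K (c : K) * (v.valuation K (c : K))⁻¹ :=
          mul_le_mul_left (h1.trans (h2.trans h3)) _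
      _ = 1 := mul_inv_cancel₀ hne
  obtain ⟨w0, hw0⟩ := HeightOneSpectrum.mem_integers_of_valuation_le_one
    (R := integralClosure (S i) K) K (x * (c : K)⁻¹) hy
  -- `x = c · (x/c) ∈ c S̄_i ⊆ S_i`
  obtain ⟨b, hb⟩ := (mem_baseSubmodule_iff (S i) K).mp (hc w0)
  have hbK : ((b : S i) : K) = x := by
    have h1 := congrArg (fun z : integralClosure (S i) K => (z : K)) hb
    simp only [Subalgebra.coe_smul] at h1
    change ((b : S i) : K) = (c : K) • (w0 : K) at h1
    rw [h1, smul_eq_mul, show ((w0 : integralClosure (S i) K) : K) = x * (c : K)⁻¹ from hw0]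
    field_simp
  rw [← hbK]
  exact b.2

/-- The branch index of a branch is unique. [folklore] -/
theorem branch_unique (hS : IsFirstNeighbourhood S) {v : HeightOneSpectrum (integralClosure R K)}
    {i j : ι} (hi : ∀ x ∈ S i, v.valuation K x ≤ 1) (hj : ∀ x ∈ S j, v.valuation K x ≤ 1) :
    i = j :=
  (hS.existsUnique_branch v).unique hi hj

omit [IsLocalRing R] in
/-- An element of `S_i` of valuation `< 1` at a branch through `x'_i` is not a unit of `S_i`
(units of `S_i` are units of the valuation ring). [folklore] -/
theorem not_isUnit_of_valuation_lt_one {i : ι} {v : HeightOneSpectrum (integralClosure R K)}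
    (hv : ∀ x ∈ S i, v.valuation K x ≤ 1) {x : S i} (hx : v.valuation K (x : K) < 1) :
    ¬ IsUnit x := by
  intro hu
  obtain ⟨y, hy⟩ := hu.exists_right_inv
  have h1 : v.valuation K (x : K) * v.valuation K (y : K) = 1 := by
    rw [← map_mul, ← Subalgebra.coe_mul, hy, OneMemClass.coe_one, map_one]
  have h2 : v.valuation K (x : K) * v.valuation K (y : K) < 1 :=
    calc v.valuation K (x : K) * v.valuation K (y : K)
        ≤ v.valuation K (x : K) * 1 := mul_le_mul_right (hv _ y.2) _
      _ = v.valuation K (x : K) := mul_one _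
      _ < 1 := hx
  exact absurd h1 h2.ne

/-- **Approximation in the semilocal Dedekind domain `R̄`**: prescribed values at all branches,
up to valuation `exp(-M)` (Chinese remainder theorem in `R̄` plus density of `R̄` in each
`R̄_𝔑`). [folklore] -/
theorem exists_forall_valuation_sub_le [IsNoetherianRing R] [Module.Finite R (integralClosure R K)]
    (a : HeightOneSpectrum (integralClosure R K) → K)
    (ha : ∀ v : HeightOneSpectrum (integralClosure R K), v.valuation K (a v) ≤ 1) (M : ℕ) :
    ∃ y : integralClosure R K, ∀ v : HeightOneSpectrum (integralClosure R K),
      v.valuation K ((y : K) - a v) ≤ WithZero.exp (-(M : ℤ)) := by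
  classical
  haveI : Finite (HeightOneSpectrum (integralClosure R K)) := finite_heightOneSpectrum R K
  haveI : Fintype (HeightOneSpectrum (integralClosure R K)) := Fintype.ofFinite _
  -- local approximations by elements of `R̄`
  have hloc : ∀ v : HeightOneSpectrum (integralClosure R K), ∃ b : integralClosure R K,
      v.valuation K ((b : K) - a v) ≤ WithZero.exp (-(M : ℤ)) := by
    intro v
    obtain ⟨b, hb⟩ := HeightOneSpectrum.exists_valuation_sub_lt_of_integer v (ha v)
      (Units.mk0 (WithZero.exp (-(M : ℤ))) WithZero.exp_ne_zero)
    exact ⟨b, hb.le⟩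
  choose b hb using hloc
  -- Chinese remainder theorem
  obtain ⟨y, hy⟩ := IsDedekindDomain.exists_forall_sub_mem_ideal (s := Finset.univ)
    (fun v : HeightOneSpectrum (integralClosure R K) => v.asIdeal) (fun _ => M)
    (fun v _ => v.prime) (fun v _ w _ hvw h => hvw (HeightOneSpectrum.ext h)) (fun v => b v.1)
  refine ⟨y, fun v => ?_⟩
  have h1 : v.valuation K ((y : K) - (b v : K)) ≤ WithZero.exp (-(M : ℤ)) := by
    have := hy v (Finset.mem_univ v)
    rw [← HeightOneSpectrum.intValuation_le_pow_iff_mem, ← HeightOneSpectrum.valuation_of_algebraMap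
      (K := K)] at this
    simpa using this
  calc v.valuation K ((y : K) - a v)
      = v.valuation K (((y : K) - (b v : K)) + ((b v : K) - a v)) := by ring_nf
    _ ≤ max (v.valuation K ((y : K) - (b v : K))) (v.valuation K ((b v : K) - a v)) :=
        Valuation.map_add _ _ _
    _ ≤ WithZero.exp (-(M : ℤ)) := max_le h1 (hb v)

/-- **Partition of unity along the branches**: `s_i ∈ R̄` with `s_i ≡ 1` to order `M` at the
branches through `x'_i` and `s_i ≡ 0` to order `M` at all other branches. [cite: Kollar2007, §1.4] -/
theorem exists_partition [IsNoetherianRing R] [Module.Finite R (integralClosure R K)] (M : ℕ)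
    (i : ι) : ∃ s : integralClosure R K,
      (∀ v : HeightOneSpectrum (integralClosure R K), (∀ x ∈ S i, v.valuation K x ≤ 1) →
        v.valuation K ((s : K) - 1) ≤ WithZero.exp (-(M : ℤ))) ∧
      (∀ v : HeightOneSpectrum (integralClosure R K), ¬ (∀ x ∈ S i, v.valuation K x ≤ 1) →
        v.valuation K (s : K) ≤ WithZero.exp (-(M : ℤ))) := by
  classical
  let a : HeightOneSpectrum (integralClosure R K) → K :=
    fun v => if (∀ x ∈ S i, v.valuation K x ≤ 1) then 1 else 0
  have ha : ∀ v : HeightOneSpectrum (integralClosure R K), v.valuation K (a v) ≤ 1 := fun v => by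
    by_cases h : ∀ x ∈ S i, v.valuation K x ≤ 1
    · simp [a, if_pos h]
    · simp [a, if_neg h]
  obtain ⟨y, hy⟩ := exists_forall_valuation_sub_le (R := R) (K := K) a ha M
  refine ⟨y, fun v hv => ?_, fun v hv => ?_⟩
  · simpa [a, if_pos hv] using hy v
  · simpa [a, if_neg hv] using hy v

/-- **The first neighbourhood ring `R₁ = ⋂ S_i` lies in `R̄`** (every branch dominates some
`S_i`, and `R̄` is the intersection of its localizations). [cite: Kollar2007, §1.4] -/
theorem iInf_le_integralClosure (hS : IsFirstNeighbourhood S) :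
    (⨅ i, S i) ≤ integralClosure R K := by
  intro x hx
  rw [Algebra.mem_iInf] at hx
  obtain ⟨a, ha⟩ := HeightOneSpectrum.mem_integers_of_valuation_le_one
    (R := integralClosure R K) K x (fun v => by
      obtain ⟨i, hi, -⟩ := hS.existsUnique_branch v
      exact hi x (hx i))
  rw [← ha]; exact a.2

/-- **Partition elements lying in every `S_j`**, with a uniform conductor bound `M ≥ 1`.
[cite: Kollar2007, §1.4] -/
theorem exists_partition_mem [IsNoetherianRing R] [Module.Finite R (integralClosure R K)]
    [Fintype ι] (hS : IsFirstNeighbourhood S) :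
    ∃ (M : ℕ) (s : ι → integralClosure R K), 1 ≤ M ∧
      (∀ i (x : K), (∀ v : HeightOneSpectrum (integralClosure R K),
        (∀ y ∈ S i, v.valuation K y ≤ 1) → v.valuation K x ≤ WithZero.exp (-(M : ℤ))) → x ∈ S i) ∧
      (∀ i (v : HeightOneSpectrum (integralClosure R K)), (∀ x ∈ S i, v.valuation K x ≤ 1) →
        v.valuation K ((s i : K) - 1) ≤ WithZero.exp (-(M : ℤ))) ∧
      (∀ i (v : HeightOneSpectrum (integralClosure R K)), ¬ (∀ x ∈ S i, v.valuation K x ≤ 1) →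
        v.valuation K (s i : K) ≤ WithZero.exp (-(M : ℤ))) ∧
      ∀ i j, (s i : K) ∈ S j := by
  classical
  choose Mi hMi using fun i => hS.exists_bound i
  set M : ℕ := max 1 (Finset.univ.sup Mi) with hM
  have hMle : ∀ i, WithZero.exp (-(M : ℤ)) ≤ WithZero.exp (-(Mi i : ℤ)) := fun i => by
    rw [WithZero.exp_le_exp, neg_le_neg_iff, Int.ofNat_le]
    exact (Finset.le_sup (Finset.mem_univ i)).trans (le_max_right _ _)
  have hbound : ∀ i (x : K), (∀ v : HeightOneSpectrum (integralClosure R K),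
      (∀ y ∈ S i, v.valuation K y ≤ 1) → v.valuation K x ≤ WithZero.exp (-(M : ℤ))) → x ∈ S i :=
    fun i x hx => hMi i x fun v hv => (hx v hv).trans (hMle i)
  choose s hs1 hs0 using fun i => exists_partition (R := R) (K := K) (S := S) M i
  refine ⟨M, s, le_max_left _ _, hbound, hs1, hs0, fun i j => ?_⟩
  by_cases hij : i = j
  · subst hij
    have h : (s i : K) - 1 ∈ S i := hbound i _ fun v hv => hs1 i v hv
    have := (S i).add_mem h (S i).one_mem
    rwa [sub_add_cancel] at this
  · refine hbound j _ fun v hv => hs0 i v fun hv' => hij (hS.branch_unique hv' hv)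

/-- The index set is non-empty (a branch exists as soon as `R` is not a field). [folklore] -/
theorem nonempty_index [IsNoetherianRing R] (hS : IsFirstNeighbourhood S)
    (hdim : ringKrullDim R = 1) : Nonempty ι := by
  have hnf : ¬ IsField R := (ringKrullDim_eq_one_iff_of_isLocalRing_isDomain.mp hdim).1
  have hnf' : ¬ IsField (integralClosure R K) := by
    intro hF
    exact hnf ((Algebra.IsIntegral.isField_iff_isField (R := R) (S := integralClosure R K)
      (fun x y h => IsFractionRing.injective R K (by simpa using congrArg Subtype.val h))).mpr hF)
  obtain ⟨𝔑, h𝔑⟩ := Ideal.exists_maximal (integralClosure R K)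
  have h𝔑0 : 𝔑 ≠ ⊥ := Ring.ne_bot_of_isMaximal_of_not_isField h𝔑 hnf'
  obtain ⟨i, -, -⟩ := hS.existsUnique_branch ⟨𝔑, h𝔑.isPrime, h𝔑0⟩
  exact ⟨i⟩

/-- **`R₁ = ⋂ S_i` is strictly bigger than `R` unless `R` is regular**: with the partition
elements `s_i` and generators `𝔪 ⊆ t_i S_i`, the element `u = Σ s_i t_i` generates `𝔪 S_j` for
every `j`, so `𝔪 ⊆ u R₁`; if `R₁ = R` then `𝔪 = uR` is principal and `R` is a discrete valuation
ring. [cite: Kollar2007, §1.4] -/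
theorem exists_mem_iInf_notMem_bot [IsNoetherianRing R] [Module.Finite R (integralClosure R K)]
    [Fintype ι] (hS : IsFirstNeighbourhood S) (hdim : ringKrullDim R = 1)
    (hR : ¬ IsDiscreteValuationRing R) :
    ∃ z : K, z ∈ (⨅ i, S i) ∧ z ∉ (⊥ : Subalgebra R K) := by
  classical
  haveI := hS.nonempty_index hdim
  by_contra hcon
  push Not at hcon
  have hnf : ¬ IsField R := (ringKrullDim_eq_one_iff_of_isLocalRing_isDomain.mp hdim).1
  have hm0 : maximalIdeal R ≠ ⊥ := isField_iff_maximalIdeal_eq.not.mp hnf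
  obtain ⟨M, s, hM1, hbound, hs1, hs0, hsmem⟩ := hS.exists_partition_mem
  choose t ht htdiv using hS.exists_generator
  -- the `s_i` lie in `R₁ = R`
  have hsR : ∀ i, (s i : K) ∈ (⊥ : Subalgebra R K) :=
    fun i => hcon _ (Algebra.mem_iInf.mpr (hsmem i))
  choose r hr using fun i => Algebra.mem_bot.mp (hsR i)
  -- `u = Σ r_i t_i`
  set u₀ : R := ∑ i, r i * t i with hu₀
  have hu₀m : u₀ ∈ maximalIdeal R :=
    Ideal.sum_mem _ fun i _ => Ideal.mul_mem_left _ _ (ht i)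
  have hlt1 : WithZero.exp (-(M : ℤ)) < 1 := by
    rw [← WithZero.exp_zero, WithZero.exp_lt_exp]; omega
  -- `t_j ≠ 0`
  have ht0 : ∀ j, algebraMap R K (t j) ≠ 0 := by
    intro j h
    obtain ⟨m, hm, hm0'⟩ := Submodule.exists_mem_ne_zero_of_ne_bot hm0
    obtain ⟨b, -, hb⟩ := htdiv j m hm
    rw [h, zero_mul] at hb
    exact hm0' (IsFractionRing.injective R K (by rw [hb, map_zero]))
  -- for each `j`: `u = t_j · e_j` with `e_j` a unit of `S_j`
  have hunit : ∀ j, ∃ e : S j, IsUnit e ∧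
      algebraMap R K u₀ = algebraMap R K (t j) * (e : K) := by
    intro j
    haveI := hS.isLocalRing j
    choose b hbS hb using fun i => htdiv j (t i) (ht i)
    obtain ⟨v0, hv0⟩ := hS.exists_branch j
    have heS : (∑ i, (s i : K) * b i) ∈ S j :=
      Subalgebra.sum_mem _ fun i _ => (S j).mul_mem (hsmem i j) (hbS i)
    refine ⟨⟨_, heS⟩, ?_, ?_⟩
    · -- `e = 1 + n` with `n` in the maximal ideal of `S_j`
      have hbj : b j = 1 := by
        have h := hb j
        rw [eq_comm, mul_eq_left₀ (ht0 j)] at h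
        exact h
      have hnval : ∀ v : HeightOneSpectrum (integralClosure R K), (∀ x ∈ S j, v.valuation K x ≤ 1) →
          v.valuation K ((∑ i, (s i : K) * b i) - 1) < 1 := by
        intro v hv
        have hsplit : (∑ i, (s i : K) * b i) - 1 =
            ((s j : K) - 1) + ∑ i ∈ Finset.univ.erase j, (s i : K) * b i := by
          rw [← Finset.add_sum_erase _ _ (Finset.mem_univ j), hbj, mul_one]; ring
        rw [hsplit]
        refine lt_of_le_of_lt (Valuation.map_add _ _ _) (max_lt ((hs1 j v hv).trans_lt hlt1) ?_)
        refine lt_of_le_of_lt (Valuation.map_sum_le _ fun i hi => ?_) hlt1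
        have hij : i ≠ j := Finset.ne_of_mem_erase hi
        rw [map_mul]
        calc v.valuation K (s i : K) * v.valuation K (b i)
            ≤ WithZero.exp (-(M : ℤ)) * 1 :=
              mul_le_mul' (hs0 i v fun hv' => hij (hS.branch_unique hv' hv)) (hv _ (hbS i))
          _ = WithZero.exp (-(M : ℤ)) := mul_one _
      have hnS : (∑ i, (s i : K) * b i) - 1 ∈ S j := (S j).sub_mem heS (S j).one_mem
      have hnunit : ¬ IsUnit (⟨_, hnS⟩ : S j) :=
        not_isUnit_of_valuation_lt_one hv0 (hnval v0 hv0)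
      have hnmax : (⟨_, hnS⟩ : S j) ∈ maximalIdeal (S j) :=
        (IsLocalRing.mem_maximalIdeal _).mpr hnunit
      have he : (⟨_, heS⟩ : S j) = 1 + ⟨_, hnS⟩ := Subtype.ext (by simp)
      rw [he]
      -- `1 + n` is a unit of the local ring `S_j`
      by_contra hu
      have h1 : (1 : S j) + ⟨_, hnS⟩ ∈ maximalIdeal (S j) := (IsLocalRing.mem_maximalIdeal _).mpr hu
      have h2 := sub_mem h1 hnmax
      rw [add_sub_cancel_right] at h2
      exact (IsLocalRing.maximalIdeal.isMaximal (S j)).ne_top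
        (Ideal.eq_top_of_isUnit_mem _ h2 isUnit_one)
    · -- `u = t_j e_j`
      change algebraMap R K u₀ = algebraMap R K (t j) * ∑ i, (s i : K) * b i
      simp only [hu₀, map_sum, map_mul, hr, Finset.mul_sum]
      refine Finset.sum_congr rfl fun i _ => ?_
      rw [hb i]; ring
  choose e heu he using hunit
  obtain ⟨j0⟩ := (inferInstance : Nonempty ι)
  have heK : ∀ j, ((e j : S j) : K) ≠ 0 := fun j h => (heu j).ne_zero (Subtype.ext h)
  -- `𝔪 ⊆ (u₀)`
  have hsub : maximalIdeal R ≤ Ideal.span {u₀} := by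
    intro m hm
    -- `m / u ∈ ⋂ S_j = R`
    have hmem : algebraMap R K m * (algebraMap R K u₀)⁻¹ ∈ ⨅ j, S j := by
      refine Algebra.mem_iInf.mpr fun j => ?_
      obtain ⟨c, hcS, hc⟩ := htdiv j m hm
      have hinv : ((((heu j).unit⁻¹ : (S j)ˣ) : S j) : K) = ((e j : S j) : K)⁻¹ := by
        have h1 : (((heu j).unit⁻¹ : (S j)ˣ) : S j) * e j = 1 := (heu j).val_inv_mul
        have h2 := congrArg (fun z : S j => (z : K)) h1
        simp only [Subalgebra.coe_mul, OneMemClass.coe_one] at h2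
        exact eq_inv_of_mul_eq_one_left h2
      have : algebraMap R K m * (algebraMap R K u₀)⁻¹ =
          c * ((((heu j).unit⁻¹ : (S j)ˣ) : S j) : K) := by
        rw [hinv, hc, he j]
        field_simp [ht0 j, heK j]
      rw [this]
      exact (S j).mul_mem hcS (SetLike.coe_mem _)
    obtain ⟨q, hq⟩ := Algebra.mem_bot.mp (hcon _ hmem)
    refine Ideal.mem_span_singleton'.mpr ⟨q, IsFractionRing.injective R K ?_⟩
    have hu0 : algebraMap R K u₀ ≠ 0 := by
      rw [he j0]; exact mul_ne_zero (ht0 j0) (heK j0)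
    rw [map_mul, hq]
    field_simp
  have heq : maximalIdeal R = Ideal.span {u₀} :=
    le_antisymm hsub ((Ideal.span_singleton_le_iff_mem _).mpr hu₀m)
  have hP : (maximalIdeal R).IsPrincipal := ⟨⟨u₀, heq⟩⟩
  exact hR (((IsDiscreteValuationRing.TFAE R hnf).out 0 4).mpr hP)

omit [IsLocalRing R] in
/-- Elements of `S̄_i` are integral at the branches through `x'_i`. [folklore] -/
theorem valuation_le_one_of_mem_integralClosure {i : ι}
    {v : HeightOneSpectrum (integralClosure R K)} (hv : ∀ x ∈ S i, v.valuation K x ≤ 1)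
    {y : K} (hy : y ∈ integralClosure (S i) K) : v.valuation K y ≤ 1 := by
  have h := integralClosure_le_valuationSubring (R := S i) (K := K) (v.valuation K).valuationSubring
    (fun r => (Valuation.mem_valuationSubring_iff _ _).mpr (hv _ r.2)) y hy
  exact (Valuation.mem_valuationSubring_iff _ _).mp h

end IsFirstNeighbourhood

/-! ## Lengths -/

section Length

variable {A : Type*} [CommRing A] {M : Type*} [AddCommGroup M] [Module A M]

omit [IsDomain R] [IsLocalRing R] [IsFractionRing R K] [IsDedekindDomain (integralClosure R K)] in
/-- Lengths can only grow under restriction of scalars. [folklore] -/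
theorem length_le_length_restrictScalars' (B : Type*) [CommRing B] [Algebra A B] [Module B M]
    [IsScalarTower A B M] : Module.length B M ≤ Module.length A M := by
  have h := Submodule.length_le_length_restrictScalars (A := A) (⊤ : Submodule B M)
  rw [Submodule.restrictScalars_top] at h
  rwa [Submodule.topEquiv.length_eq, Submodule.topEquiv.length_eq] at h

omit [IsDomain R] [IsLocalRing R] [IsFractionRing R K] [IsDedekindDomain (integralClosure R K)] in
/-- **Additivity of length along `p ≤ q ≤ M`**: `ℓ(M/p) = ℓ(q/p) + ℓ(M/q)`, with `q/p` realised as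
the image of `q` in `M/p`. [folklore] -/
theorem length_quotient_eq_add {p q : Submodule A M} (h : p ≤ q) :
    Module.length A (M ⧸ p) =
      Module.length A (q.map p.mkQ) + Module.length A (M ⧸ q) := by
  rw [Module.length_eq_add_of_exact (q.map p.mkQ).subtype (q.map p.mkQ).mkQ
    (Submodule.injective_subtype _) (Submodule.mkQ_surjective _) (LinearMap.exact_subtype_mkQ _),
    (Submodule.quotientQuotientEquivQuotient p q h).length_eq]

omit [IsDomain R] [IsLocalRing R] [IsFractionRing R K] [IsDedekindDomain (integralClosure R K)] in
/-- The length of `M / ker Φ` for `Φ` onto a finite product. [folklore] -/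
theorem length_quotient_eq_sum_of_ker_eq [Fintype ι] (Q : ι → Type*) [∀ i, AddCommGroup (Q i)]
    [∀ i, Module A (Q i)] (Φ : M →ₗ[A] Π i, Q i) (hΦ : Function.Surjective Φ)
    (p : Submodule A M) (hp : LinearMap.ker Φ = p) :
    Module.length A (M ⧸ p) = ∑ i, Module.length A (Q i) := by
  rw [← (Submodule.quotEquivOfEq _ _ hp).length_eq,
    (LinearMap.quotKerEquivOfSurjective Φ hΦ).length_eq]
  exact Module.length_pi_of_fintype A _

end Length

/-! ## The inequality `Σ δ(S_i) < δ(R)` -/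

namespace IsFirstNeighbourhood

omit [IsDomain R] [IsLocalRing R] [IsFractionRing R K] [IsDedekindDomain (integralClosure R K)] in
/-- `δ(R)` computed inside `K`: `R̄/R ≅ R̄ₘ/(R ∩ R̄ₘ)` for the `R`-submodules of `K`. [folklore] -/
theorem curveDelta_eq_length_quotient :
    curveDelta R K = Module.length R
      (↥(Subalgebra.toSubmodule (integralClosure R K)) ⧸
        (Subalgebra.toSubmodule (⊥ : Subalgebra R K)).comap
          (Subalgebra.toSubmodule (integralClosure R K)).subtype) := by
  let e : integralClosure R K ≃ₗ[R] ↥(Subalgebra.toSubmodule (integralClosure R K)) :=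
    { toFun := fun a => ⟨a, a.2⟩
      invFun := fun a => ⟨a, a.2⟩
      map_add' := fun _ _ => rfl
      map_smul' := fun _ _ => rfl
      left_inv := fun _ => rfl
      right_inv := fun _ => rfl }
  refine (Submodule.Quotient.equiv (baseSubmodule R K) _ e ?_).length_eq
  apply le_antisymm
  · rintro _ ⟨w, hw, rfl⟩
    obtain ⟨r, rfl⟩ := (mem_baseSubmodule_iff R K).mp hw
    exact Algebra.mem_bot.mpr ⟨r, rfl⟩
  · intro y hy
    obtain ⟨r, hr⟩ := Algebra.mem_bot.mp hy
    refine ⟨algebraMap R _ r, (mem_baseSubmodule_iff R K).mpr ⟨r, rfl⟩, Subtype.ext ?_⟩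
    exact hr

omit [IsDomain R] [IsLocalRing R] [IsFractionRing R K] [IsDedekindDomain (integralClosure R K)] in
/-- `δ(S_i)` is dominated by the `R`-length of `S̄_i/S_i` computed inside `K`. [folklore] -/
theorem curveDelta_le_length_quotient (i : ι) :
    curveDelta (S i) K ≤ Module.length R
      (↥((Subalgebra.toSubmodule (integralClosure (S i) K)).restrictScalars R) ⧸
        (Subalgebra.toSubmodule (S i)).comap
          ((Subalgebra.toSubmodule (integralClosure (S i) K)).restrictScalars R).subtype) := by
  -- `δ(S_i) = ℓ_{S_i}(S̄_i/S_i) ≤ ℓ_R(S̄_i/S_i)`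
  refine (length_le_length_restrictScalars' (A := R) (S i)).trans (le_of_eq ?_)
  -- transport along the tautological identifications
  let e : integralClosure (S i) K ≃ₗ[R]
      ↥((Subalgebra.toSubmodule (integralClosure (S i) K)).restrictScalars R) :=
    { toFun := fun a => ⟨a, a.2⟩
      invFun := fun a => ⟨a, a.2⟩
      map_add' := fun _ _ => rfl
      map_smul' := fun _ _ => rfl
      left_inv := fun _ => rfl
      right_inv := fun _ => rfl }
  rw [← (Submodule.Quotient.restrictScalarsEquiv R (baseSubmodule (S i) K)).length_eq]
  refine (Submodule.Quotient.equiv ((baseSubmodule (S i) K).restrictScalars R) _ e ?_).length_eq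
  apply le_antisymm
  · rintro _ ⟨w, hw, rfl⟩
    obtain ⟨r, rfl⟩ := (mem_baseSubmodule_iff (S i) K).mp hw
    exact r.2
  · intro y hy
    exact ⟨algebraMap (S i) _ ⟨(y : K), hy⟩, (mem_baseSubmodule_iff (S i) K).mpr ⟨_, rfl⟩,
      Subtype.ext rfl⟩

/-- **`Σ_i δ(S_i) < δ(R)` for a non-regular one-dimensional local domain `R`** with finite
normalization and a first neighbourhood `(S_i)`: the `δ`-invariant drops strictly under blowing
up a singular point (Kollár 2007, §1.4; the input "by embedded resolution of curves" of
Cossart–Piltant 2008, proof of Prop. 4.4). [cite: Kollar2007, §1.4]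
[cite: CossartPiltant2008, proof of Prop. 4.4, p. 10] -/
theorem sum_curveDelta_lt [IsNoetherianRing R] [Module.Finite R (integralClosure R K)]
    [Fintype ι] (hS : IsFirstNeighbourhood S) (hdim : ringKrullDim R = 1)
    (hR : ¬ IsDiscreteValuationRing R) :
    ∑ i, curveDelta (S i) K < curveDelta R K := by
  classical
  -- notation: the `R`-submodules of `K` (kept opaque)
  obtain ⟨Λ, hΛ⟩ : ∃ Λ : Submodule R K, Λ = Subalgebra.toSubmodule (integralClosure R K) := ⟨_, rfl⟩
  obtain ⟨B0, hB0⟩ : ∃ B0 : Submodule R K, B0 = Subalgebra.toSubmodule (⊥ : Subalgebra R K) :=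
    ⟨_, rfl⟩
  obtain ⟨R₁, hR₁⟩ : ∃ R₁ : Submodule R K, R₁ = Subalgebra.toSubmodule (⨅ i, S i) := ⟨_, rfl⟩
  obtain ⟨Λi, hΛi⟩ : ∃ Λi : ι → Submodule R K,
      ∀ i, Λi i = (Subalgebra.toSubmodule (integralClosure (S i) K)).restrictScalars R :=
    ⟨_, fun _ => rfl⟩
  obtain ⟨Si, hSi⟩ : ∃ Si : ι → Submodule R K, ∀ i, Si i = Subalgebra.toSubmodule (S i) :=
    ⟨_, fun _ => rfl⟩
  have mΛ : ∀ z : K, z ∈ Λ ↔ z ∈ integralClosure R K := fun z => by rw [hΛ]; rfl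
  have mB0 : ∀ z : K, z ∈ B0 ↔ z ∈ (⊥ : Subalgebra R K) := fun z => by rw [hB0]; rfl
  have mR₁ : ∀ z : K, z ∈ R₁ ↔ ∀ i, z ∈ S i := fun z => by
    rw [hR₁, Subalgebra.mem_toSubmodule, Algebra.mem_iInf]
  have mΛi : ∀ i (z : K), z ∈ Λi i ↔ z ∈ integralClosure (S i) K := fun i z => by rw [hΛi]; rfl
  have mSi : ∀ i (z : K), z ∈ Si i ↔ z ∈ S i := fun i z => by rw [hSi]; rfl
  have hB0R₁ : B0.comap Λ.subtype ≤ R₁.comap Λ.subtype := by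
    refine Submodule.comap_mono fun x hx => ?_
    obtain ⟨r, rfl⟩ := Algebra.mem_bot.mp ((mB0 x).mp hx)
    exact (mR₁ _).mpr fun i => (S i).algebraMap_mem r
  have hΛΛi : ∀ i, Λ ≤ Λi i := fun i x hx =>
    (mΛi i x).mpr (coe_mem_integralClosure i ⟨x, (mΛ x).mp hx⟩)
  -- the comparison map `Φ : R̄ → Π S̄_i/S_i`
  obtain ⟨Φ, hΦ⟩ : ∃ Φ : ↥Λ →ₗ[R] (Π i, ↥(Λi i) ⧸ (Si i).comap (Λi i).subtype),
      ∀ x i, Φ x i = Submodule.Quotient.mk (Submodule.inclusion (hΛΛi i) x) :=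
    ⟨LinearMap.pi fun i => ((Si i).comap (Λi i).subtype).mkQ.comp (Submodule.inclusion (hΛΛi i)),
      fun _ _ => rfl⟩
  have hkerΦ : LinearMap.ker Φ = R₁.comap Λ.subtype := by
    ext x
    simp only [LinearMap.mem_ker, funext_iff, hΦ, Pi.zero_apply, Submodule.Quotient.mk_eq_zero,
      Submodule.mem_comap, Submodule.subtype_apply, Submodule.coe_inclusion, mR₁, mSi]
  -- `Φ` is onto, by approximation in `R̄`
  obtain ⟨M, s, -, hbound, -, -, -⟩ := hS.exists_partition_mem
  have hsurj : Function.Surjective Φ := by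
    intro f
    choose y hy using fun i => Submodule.Quotient.mk_surjective _ (f i)
    -- branch index of a branch
    let idx : HeightOneSpectrum (integralClosure R K) → ι :=
      fun v => (hS.existsUnique_branch v).exists.choose
    have hidx : ∀ v, ∀ x ∈ S (idx v), v.valuation K x ≤ 1 :=
      fun v => (hS.existsUnique_branch v).exists.choose_spec
    obtain ⟨x, hx⟩ := exists_forall_valuation_sub_le (R := R) (K := K)
      (fun v => (y (idx v) : K)) (fun v => valuation_le_one_of_mem_integralClosure (hidx v)
        ((mΛi _ _).mp (y (idx v)).2)) M
    refine ⟨⟨x, (mΛ _).mpr x.2⟩, funext fun i => ?_⟩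
    rw [← hy i, hΦ, Submodule.Quotient.eq, Submodule.mem_comap, Submodule.subtype_apply, mSi]
    change (x : K) - (y i : K) ∈ S i
    refine hbound i _ fun v hv => ?_
    have hi : idx v = i := hS.branch_unique (hidx v) hv
    have := hx v
    rwa [hi] at this
  -- lengths
  have hΦiso : Module.length R (↥Λ ⧸ R₁.comap Λ.subtype) =
      ∑ i, Module.length R (↥(Λi i) ⧸ (Si i).comap (Λi i).subtype) := by
    exact length_quotient_eq_sum_of_ker_eq (fun i => ↥(Λi i) ⧸ (Si i).comap (Λi i).subtype) Φ
      hsurj _ hkerΦ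
  have hδR : curveDelta R K = Module.length R ((R₁.comap Λ.subtype).map (B0.comap Λ.subtype).mkQ) +
      ∑ i, Module.length R (↥(Λi i) ⧸ (Si i).comap (Λi i).subtype) := by
    rw [curveDelta_eq_length_quotient, ← hΛ, ← hB0, length_quotient_eq_add hB0R₁, hΦiso]
  -- the first summand is `≥ 1`: `R₁ ≠ R`
  have hpos : 1 ≤ Module.length R ((R₁.comap Λ.subtype).map (B0.comap Λ.subtype).mkQ) := by
    obtain ⟨z, hz1, hz0⟩ := hS.exists_mem_iInf_notMem_bot hdim hR
    have hzΛ : z ∈ Λ := (mΛ z).mpr (hS.iInf_le_integralClosure hz1)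
    have hzR₁ : z ∈ R₁ := (mR₁ z).mpr (Algebra.mem_iInf.mp hz1)
    rw [Order.one_le_iff_ne_zero, Ne, Module.length_eq_zero_iff, not_subsingleton_iff_nontrivial]
    refine ⟨⟨⟨_, ⟨⟨z, hzΛ⟩, hzR₁, rfl⟩⟩, 0, fun h => hz0 ((mB0 z).mp ?_)⟩⟩
    have h' := congrArg Subtype.val h
    simp only [ZeroMemClass.coe_zero, Submodule.mkQ_apply, Submodule.Quotient.mk_eq_zero,
      Submodule.mem_comap, Submodule.subtype_apply] at h'
    exact h'
  -- the second dominates `Σ δ(S_i)`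
  have hsum : ∑ i, curveDelta (S i) K ≤
      ∑ i, Module.length R (↥(Λi i) ⧸ (Si i).comap (Λi i).subtype) := by
    refine Finset.sum_le_sum fun i _ => ?_
    rw [hΛi i, hSi i]
    exact curveDelta_le_length_quotient (R := R) (K := K) (S := S) i
  have htop : curveDelta R K ≠ ⊤ := curveDelta_ne_top K hdim
  -- conclude in `ℕ∞`
  set a := Module.length R ((R₁.comap Λ.subtype).map (B0.comap Λ.subtype).mkQ) with ha
  set b := ∑ i, Module.length R (↥(Λi i) ⧸ (Si i).comap (Λi i).subtype) with hb
  have hbtop : b ≠ ⊤ := by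
    intro h; apply htop; rw [hδR, h, add_top]
  calc ∑ i, curveDelta (S i) K ≤ b := hsum
    _ < b + 1 := (ENat.lt_add_one_iff hbtop).mpr le_rfl
    _ ≤ b + a := add_le_add le_rfl hpos
    _ = curveDelta R K := by rw [hδR, add_comm]

end IsFirstNeighbourhood

end Drop


end Literature.AlgebraicGeometry.Resolution

end
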